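import Literature.NumberTheory.Automorphic.AutomorphicRepsGLCuspidalL2Step1KFinite
import Literature.NumberTheory.Automorphic.UnramifiedHeckeScalarsProofs
import Mathlib.Analysis.Calculus.BumpFunction.InnerProduct
import HarnessLib

/-!
# `Ad K_∞`-invariant symmetric test functions on `GL_n(𝔸_K)` with small support
(discharge of W1, `AutomorphicRepsGL.exists_adInvariant_symmetric_testWeight`, of
`AutomorphicRepsGLCuspidalL2Step1KFinite`)

Topic `NumberTheory/Automorphic`; sibling proof file of `AutomorphicRepsGLCuspidalL2Step1KFinite`,
which reduces F1a of Step 1 of Borel–Jacquet 4.6 for `GL_n` (`K_∞`-finite Gårding-fixed vectors in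
an irreducible `Π ≤ L²_cusp`) to the Siegel estimate, reduction theory, unimodularity of
`GL_n(𝔸_K)` and the named fact W1: every neighbourhood of `1` in `GL_n(𝔸_K)` supports a
non-negative test function `η` (`IsTestFunctionGL`) of positive mass with `η(g⁻¹) = η(g)`,
`η(k g k⁻¹) = η(g)` (`k ∈ K_∞`), left invariant under a level. This file PROVES W1
(`AutomorphicRepsGL.exists_adInvariant_symmetric_testWeight_holds`) by the explicit construction
`η(g) = φ(Q(g_∞ - 1)) φ(Q(g_∞⁻¹ - 1)) · 1_{K_f(𝔫)}(g_f)`, where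

* `hsQ z = Re tr(zᴴ z) = ∑_{i,j} ‖z_{ij}‖²_{L²}` is the Hilbert–Schmidt form on `M_n(K ⊗ ℝ)`
  (`mixedRe` the real-part functional on `K ⊗ ℝ = ℝ^{r₁} × ℂ^{r₂}`): a smooth positive definite
  quadratic form (`contDiff_hsQ`, `hsQ_nonneg`, `eq_zero_of_hsQ_eq_zero`, `hsQ_smul`), invariant
  under conjugation by the unitary group `K_∞ = U(n, K ⊗ ℝ)` (`hsQ_units_conj`, cyclicity of the
  trace), and coercive (`exists_hsQ_lt_imp_norm_lt`: minimise `Q` on a compact sphere);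
* `archBump φ x = φ(Q(x - 1)) φ(Q(x⁻¹ - 1))` on `GL_n(K ⊗ ℝ)` for a bump `φ` on `ℝ` at `0`:
  non-negative, `= 1` at `1`, symmetric under `x ↦ x⁻¹`, `Ad K_∞`-invariant (`archBump_conj`),
  continuous, smooth along `X ↦ x₀ exp X` (`contDiff_archBump_mul_expGL`, as `(x₀ exp X)⁻¹ =
  exp(-X) x₀⁻¹`), and supported where `Q(x - 1) < r_out` (`hsQ_lt_of_archBump_ne_zero`);
* the finite factor `1_{K_f(𝔫)}` and the assembly follow the tree's
  `exists_isTestFunctionGL_support_subset` (`GLnCuspidalSpectrumSiegelProofs`) verbatim.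

As a corollary, F1a needs only the three remaining named inputs
(`AutomorphicRepsGL.exists_kFinite_garding_fixed_of'`). In print: Bump (1997), proof of
Lemma 2.3.2, PDF p. 163 ("We may also take `φ₀(g) = φ₀(g⁻¹)` … we may assume that
`φ₀(κ g κ⁻¹) = φ₀(g)` for all `κ ∈ K`"; Bump averages a symmetric bump over the compact `K`,
here the invariance is built into the Hilbert–Schmidt form).

## Design notes

* The norm on `M_n(K ⊗ ℝ)` is the scoped operator norm (`open scoped Matrix.Norms.Operator`, as in
  `IsArchSmooth`); the metric arguments (spheres, balls, `ProperSpace` from finite dimension) do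
  not depend on the choice. As in `AutomorphicFormsGLContinuous`,
  `set_option backward.isDefEq.respectTransparency false` is needed where this scoped structure
  meets the Pi topology (`CompleteSpace`, `Units.isOpenEmbedding_val`, continuity of `exp`).
* (H1) `attribute [local instance 100] LieRing.ofAssociativeRing`; local Borel instances as in
  `SmoothedAutomorphicForms`; the tree's `finiteDimensional_matrix_mixedSpace` as a local instance.
  No `sorry`, no new instance, no new named fact.

## References

* D. Bump, *Automorphic Forms and Representations* (1997), proof of Lemma 2.3.2 (PDF p. 163),
  (9.2) (PDF p. 240), proof of Thm. 3.2.3 (PDF p. 281) [Bump1997].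
* J. R. Getz, H. Hahn, *An Introduction to Automorphic Representations*, GTM 300 (2024), §9.3
  (printed p. 179), Exercise 9.7 [GetzHahn2024].
* A. Borel, H. Jacquet, *Automorphic forms and automorphic representations* (1979), §4.6
  [BorelJacquet1979].
-/

-- Mathlib idiom (Mathlib/Algebra/Lie/OfAssociative.lean); needed to mention Lie subalgebras of matrix algebras
attribute [local instance 100] LieRing.ofAssociativeRing

open scoped MatrixGroups Matrix ContDiff Classical Topology Pointwise
open NumberField NumberField.mixedEmbedding IsDedekindDomain Filter
open _root_.MeasureTheory

noncomputable section

namespace Literature.NumberTheory.Automorphic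

attribute [local instance] adelicBorel borelSpace_adelic locallyCompactSpace_adelic
  secondCountableTopology_gl_adelic

-- `M_n(K ⊗ ℝ)` is finite-dimensional over `ℝ` (the tree's instance, as in
-- `GLnCuspidalSpectrumSiegelProofs`)
attribute [local instance] finiteDimensional_matrix_mixedSpace

/-! ### 1. The Hilbert–Schmidt form on `M_n(K ⊗ ℝ)` -/

section HSForm

variable {n : ℕ} {K : Type} [Field K] [NumberField K]

/-- The real part functional on `K ⊗ ℝ = ℝ^{r₁} × ℂ^{r₂}`:
`a ↦ ∑_{w real} a_w + ∑_{w complex} Re a_w`. [folklore] -/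
def mixedRe : mixedSpace K →ₗ[ℝ] ℝ where
  toFun a := ∑ w, a.1 w + ∑ w, (a.2 w).re
  map_add' a b := by
    simp only [Prod.fst_add, Pi.add_apply, Prod.snd_add, Complex.add_re, Finset.sum_add_distrib]
    ring
  map_smul' t a := by
    simp only [Prod.smul_fst, Prod.smul_snd, Pi.smul_apply, smul_eq_mul, Complex.real_smul,
      Complex.re_ofReal_mul, RingHom.id_apply, Finset.mul_sum, mul_add]

/-- `mixedRe a = ∑_{w real} a_w + ∑_{w complex} Re a_w` (definitional). [folklore] -/
theorem mixedRe_apply (a : mixedSpace K) : mixedRe a = ∑ w, a.1 w + ∑ w, (a.2 w).re := rfl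

/-- `Re (ā a) = ∑_w a_w² + ∑_w |a_w|²`. [folklore] -/
theorem mixedRe_star_mul_self (a : mixedSpace K) :
    mixedRe (star a * a) = ∑ w, (a.1 w) ^ 2 + ∑ w, Complex.normSq (a.2 w) := by
  rw [mixedRe_apply]
  congr 1
  · refine Finset.sum_congr rfl fun w _ ↦ ?_
    simp only [Prod.fst_mul, Prod.fst_star, Pi.mul_apply, star_trivial, pow_two]
  · refine Finset.sum_congr rfl fun w _ ↦ ?_
    simp only [Prod.snd_mul, Prod.snd_star, Pi.mul_apply, Pi.star_apply]
    rw [Complex.star_def, ← Complex.normSq_eq_conj_mul_self, Complex.ofReal_re]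

/-- The **Hilbert–Schmidt form** `Q(z) = Re tr(zᴴ z)` on `M_n(K ⊗ ℝ)`. [folklore] -/
def hsQ (z : Matrix (Fin n) (Fin n) (mixedSpace K)) : ℝ :=
  mixedRe (Matrix.trace (zᴴ * z))

/-- `Q(z) = ∑_{i,j} (∑_w (z_ij)_w² + ∑_w |(z_ij)_w|²)`. [folklore] -/
theorem hsQ_eq_sum (z : Matrix (Fin n) (Fin n) (mixedSpace K)) :
    hsQ z = ∑ j, ∑ i, (∑ w, ((z i j).1 w) ^ 2 + ∑ w, Complex.normSq ((z i j).2 w)) := by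
  unfold hsQ Matrix.trace
  simp only [Matrix.diag_apply, Matrix.mul_apply, Matrix.conjTranspose_apply, map_sum,
    mixedRe_star_mul_self]

/-- `Q ≥ 0`. [folklore] -/
theorem hsQ_nonneg (z : Matrix (Fin n) (Fin n) (mixedSpace K)) : 0 ≤ hsQ z := by
  rw [hsQ_eq_sum]
  exact Finset.sum_nonneg fun j _ ↦ Finset.sum_nonneg fun i _ ↦
    add_nonneg (Finset.sum_nonneg fun w _ ↦ sq_nonneg _)
      (Finset.sum_nonneg fun w _ ↦ Complex.normSq_nonneg _)

/-- `Q(z) = 0` only for `z = 0`. [folklore] -/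
theorem eq_zero_of_hsQ_eq_zero {z : Matrix (Fin n) (Fin n) (mixedSpace K)} (h : hsQ z = 0) :
    z = 0 := by
  rw [hsQ_eq_sum] at h
  have hterm : ∀ a : mixedSpace K,
      0 ≤ ∑ w, (a.1 w) ^ 2 + ∑ w, Complex.normSq (a.2 w) := fun a ↦
    add_nonneg (Finset.sum_nonneg fun w _ ↦ sq_nonneg _)
      (Finset.sum_nonneg fun w _ ↦ Complex.normSq_nonneg _)
  ext i j : 1
  change z i j = 0
  have hj := (Finset.sum_eq_zero_iff_of_nonneg fun j _ ↦
    Finset.sum_nonneg fun i _ ↦ hterm _).1 h j (Finset.mem_univ j)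
  have hij := (Finset.sum_eq_zero_iff_of_nonneg fun i _ ↦ hterm _).1 hj i (Finset.mem_univ i)
  have h12 := (add_eq_zero_iff_of_nonneg (Finset.sum_nonneg fun w _ ↦ sq_nonneg _)
    (Finset.sum_nonneg fun w _ ↦ Complex.normSq_nonneg _)).1 hij
  have h1 : (z i j).1 = 0 := funext fun w ↦ by
    have hw := (Finset.sum_eq_zero_iff_of_nonneg fun w _ ↦ sq_nonneg ((z i j).1 w)).1 h12.1 w
      (Finset.mem_univ w)
    simpa using hw
  have h2 : (z i j).2 = 0 := funext fun w ↦ by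
    have hw := (Finset.sum_eq_zero_iff_of_nonneg fun w _ ↦ Complex.normSq_nonneg ((z i j).2 w)).1
      h12.2 w (Finset.mem_univ w)
    simpa using hw
  calc z i j = ((z i j).1, (z i j).2) := rfl
    _ = (0, 0) := by rw [h1, h2]
    _ = 0 := rfl

/-- `Q(t z) = t² Q(z)`. [folklore] -/
theorem hsQ_smul (t : ℝ) (z : Matrix (Fin n) (Fin n) (mixedSpace K)) :
    hsQ (t • z) = t ^ 2 * hsQ z := by
  unfold hsQ
  rw [Matrix.conjTranspose_smul, star_trivial, Matrix.smul_mul, Matrix.mul_smul, smul_smul,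
    Matrix.trace_smul, map_smul, smul_eq_mul, pow_two]

/-- **`Q` is invariant under conjugation by unitary matrices**: `Q(k z k⁻¹) = Q(z)` for
`kᴴ k = 1` (`tr((kzk⁻¹)ᴴ (kzk⁻¹)) = tr(k zᴴ z kᴴ) = tr(zᴴ z)`). [folklore] -/
theorem hsQ_units_conj (k : GL (Fin n) (mixedSpace K))
    (hk : star (k : Matrix (Fin n) (Fin n) (mixedSpace K)) * k = 1)
    (z : Matrix (Fin n) (Fin n) (mixedSpace K)) :
    hsQ ((k : Matrix (Fin n) (Fin n) (mixedSpace K)) * z *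
      ((k⁻¹ : GL (Fin n) (mixedSpace K)) : Matrix (Fin n) (Fin n) (mixedSpace K))) = hsQ z := by
  set a : Matrix (Fin n) (Fin n) (mixedSpace K) := (k : Matrix (Fin n) (Fin n) (mixedSpace K))
    with ha
  rw [Matrix.star_eq_conjTranspose] at hk
  have hkinv :
      ((k⁻¹ : GL (Fin n) (mixedSpace K)) : Matrix (Fin n) (Fin n) (mixedSpace K)) = aᴴ := by
    rw [Matrix.coe_units_inv]
    exact Matrix.inv_eq_left_inv hk
  rw [hkinv]
  unfold hsQ
  have key : (a * z * aᴴ)ᴴ * (a * z * aᴴ) = a * (zᴴ * z) * aᴴ := by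
    calc (a * z * aᴴ)ᴴ * (a * z * aᴴ) = a * zᴴ * (aᴴ * a) * z * aᴴ := by
          rw [Matrix.conjTranspose_mul, Matrix.conjTranspose_mul,
            Matrix.conjTranspose_conjTranspose]
          simp only [Matrix.mul_assoc]
      _ = a * (zᴴ * z) * aᴴ := by
          rw [hk, Matrix.mul_one]
          simp only [Matrix.mul_assoc]
  rw [key, Matrix.trace_mul_cycle, hk, Matrix.one_mul]

-- the scoped operator norm on `𝔤𝔩_n(K_∞)` (the one through which `IsArchSmooth` is defined); the
-- finite-dimensional arguments below do not depend on the choice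
open scoped Matrix.Norms.Operator

set_option backward.isDefEq.respectTransparency false in
/-- `Q` is smooth (a polynomial). [folklore] -/
theorem contDiff_hsQ : ContDiff ℝ ∞ (hsQ (n := n) (K := K)) := by
  let cT : Matrix (Fin n) (Fin n) (mixedSpace K) →ₗ[ℝ] Matrix (Fin n) (Fin n) (mixedSpace K) :=
    { toFun := fun z ↦ zᴴ
      map_add' := fun x y ↦ Matrix.conjTranspose_add x y
      map_smul' := fun t x ↦ by rw [Matrix.conjTranspose_smul, star_trivial]; rfl }
  have h1 : ContDiff ℝ ∞ fun z : Matrix (Fin n) (Fin n) (mixedSpace K) ↦ zᴴ :=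
    (LinearMap.toContinuousLinearMap cT).contDiff
  have h2 : ContDiff ℝ ∞ fun z : Matrix (Fin n) (Fin n) (mixedSpace K) ↦ zᴴ * z :=
    h1.mul contDiff_id
  have h3 : ContDiff ℝ ∞ fun y : Matrix (Fin n) (Fin n) (mixedSpace K) ↦ mixedRe (Matrix.trace y) :=
    (LinearMap.toContinuousLinearMap
      (mixedRe ∘ₗ Matrix.traceLinearMap (Fin n) ℝ (mixedSpace K))).contDiff
  exact h3.comp h2

set_option backward.isDefEq.respectTransparency false in
/-- `Q` is continuous. [folklore] -/
theorem continuous_hsQ : Continuous (hsQ (n := n) (K := K)) :=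
  contDiff_hsQ.continuous

set_option backward.isDefEq.respectTransparency false in
/-- **Coercivity of `Q`** (topological form): for every `ε > 0` there is `r > 0` with
`Q(z) < r → ‖z‖ < ε` (minimise `Q` on the compact sphere of radius `ε`; `Q` is positive
definite and homogeneous of degree two). [folklore] -/
theorem exists_hsQ_lt_imp_norm_lt {ε : ℝ} (hε : 0 < ε) :
    ∃ r > 0, ∀ z : Matrix (Fin n) (Fin n) (mixedSpace K), hsQ z < r → ‖z‖ < ε := by
  haveI : ProperSpace (Matrix (Fin n) (Fin n) (mixedSpace K)) := FiniteDimensional.proper ℝ _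
  -- rescaling to the sphere of radius `ε`
  have hscale : ∀ z : Matrix (Fin n) (Fin n) (mixedSpace K), ε ≤ ‖z‖ →
      (ε / ‖z‖) • z ∈ Metric.sphere (0 : Matrix (Fin n) (Fin n) (mixedSpace K)) ε ∧
        0 < ε / ‖z‖ ∧ ε / ‖z‖ ≤ 1 := by
    intro z hz
    have hzpos : 0 < ‖z‖ := hε.trans_le hz
    refine ⟨?_, div_pos hε hzpos, (div_le_one hzpos).2 hz⟩
    rw [mem_sphere_zero_iff_norm, _root_.norm_smul, Real.norm_eq_abs, abs_of_pos (div_pos hε hzpos),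
      div_mul_cancel₀ _ hzpos.ne']
  by_cases hne : (Metric.sphere (0 : Matrix (Fin n) (Fin n) (mixedSpace K)) ε).Nonempty
  · obtain ⟨z₀, hz₀, hmin⟩ :=
      (isCompact_sphere (0 : Matrix (Fin n) (Fin n) (mixedSpace K)) ε).exists_isMinOn hne
        continuous_hsQ.continuousOn
    have hz₀ne : z₀ ≠ 0 := by
      rintro rfl
      rw [mem_sphere_zero_iff_norm, norm_zero] at hz₀
      exact hε.ne hz₀
    have hr : 0 < hsQ z₀ :=
      (hsQ_nonneg z₀).lt_of_ne fun h ↦ hz₀ne (eq_zero_of_hsQ_eq_zero h.symm)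
    refine ⟨hsQ z₀, hr, fun z hz ↦ ?_⟩
    by_contra hzn
    obtain ⟨hmem, ht, ht1⟩ := hscale z (not_lt.1 hzn)
    have h1 : hsQ z₀ ≤ hsQ ((ε / ‖z‖) • z) := hmin hmem
    rw [hsQ_smul] at h1
    have h2 : (ε / ‖z‖) ^ 2 * hsQ z ≤ hsQ z := by
      have : (ε / ‖z‖) ^ 2 ≤ 1 := by nlinarith
      nlinarith [hsQ_nonneg z]
    linarith
  · refine ⟨1, one_pos, fun z _ ↦ ?_⟩
    by_contra hzn
    exact hne ⟨_, (hscale z (not_lt.1 hzn)).1⟩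

end HSForm

/-! ### 2. The archimedean factor: a symmetric `Ad K_∞`-invariant bump on `GL_n(K ⊗ ℝ)` -/

section ArchBump

variable {n : ℕ} {K : Type} [Field K] [NumberField K]

open scoped Matrix.Norms.Operator

/-- The archimedean bump `α(x) = φ(Q(x - 1)) φ(Q(x⁻¹ - 1))` on `GL_n(K ⊗ ℝ)` attached to a bump
`φ` on `ℝ` at `0`. [folklore] -/
def archBump (φ : ContDiffBump (0 : ℝ)) (x : GL (Fin n) (mixedSpace K)) : ℝ :=
  φ (hsQ ((x : Matrix (Fin n) (Fin n) (mixedSpace K)) - 1)) *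
    φ (hsQ (((x⁻¹ : GL (Fin n) (mixedSpace K)) : Matrix (Fin n) (Fin n) (mixedSpace K)) - 1))

variable (φ : ContDiffBump (0 : ℝ))

/-- `α ≥ 0`. [folklore] -/
theorem archBump_nonneg (x : GL (Fin n) (mixedSpace K)) : 0 ≤ archBump φ x :=
  mul_nonneg φ.nonneg φ.nonneg

/-- `α(1) = 1` (`φ = 1` near `0`). [folklore] -/
theorem archBump_one : archBump φ (1 : GL (Fin n) (mixedSpace K)) = 1 := by
  unfold archBump
  have h0 : hsQ ((1 : Matrix (Fin n) (Fin n) (mixedSpace K)) - 1) = 0 := by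
    rw [sub_self, hsQ_eq_sum]; simp
  rw [inv_one, Units.val_one, h0, φ.one_of_mem_closedBall (Metric.mem_closedBall_self φ.rIn_pos.le),
    mul_one]

/-- **`α` is symmetric**: `α(x⁻¹) = α(x)`. [folklore] -/
theorem archBump_inv (x : GL (Fin n) (mixedSpace K)) : archBump φ x⁻¹ = archBump φ x := by
  unfold archBump
  rw [inv_inv, mul_comm]

/-- `α(k x k⁻¹) = α(x)` for unitary `k`. [folklore] -/
theorem archBump_conj {k : GL (Fin n) (mixedSpace K)}
    (hk : star (k : Matrix (Fin n) (Fin n) (mixedSpace K)) * k = 1)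
    (x : GL (Fin n) (mixedSpace K)) : archBump φ (k * x * k⁻¹) = archBump φ x := by
  unfold archBump
  have h1 : ((k * x * k⁻¹ : GL (Fin n) (mixedSpace K)) : Matrix (Fin n) (Fin n) (mixedSpace K)) -
      1 = (k : Matrix (Fin n) (Fin n) (mixedSpace K)) *
        ((x : Matrix (Fin n) (Fin n) (mixedSpace K)) - 1) *
        ((k⁻¹ : GL (Fin n) (mixedSpace K)) : Matrix (Fin n) (Fin n) (mixedSpace K)) := by
    rw [Matrix.mul_sub, Matrix.sub_mul, Matrix.mul_one, Units.mul_inv, Units.val_mul,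
      Units.val_mul]
  have h2 : (((k * x * k⁻¹)⁻¹ : GL (Fin n) (mixedSpace K)) :
      Matrix (Fin n) (Fin n) (mixedSpace K)) - 1 =
      (k : Matrix (Fin n) (Fin n) (mixedSpace K)) *
        (((x⁻¹ : GL (Fin n) (mixedSpace K)) : Matrix (Fin n) (Fin n) (mixedSpace K)) - 1) *
        ((k⁻¹ : GL (Fin n) (mixedSpace K)) : Matrix (Fin n) (Fin n) (mixedSpace K)) := by
    rw [show (k * x * k⁻¹)⁻¹ = k * x⁻¹ * k⁻¹ by group, Matrix.mul_sub, Matrix.sub_mul,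
      Matrix.mul_one, Units.mul_inv, Units.val_mul, Units.val_mul]
  rw [h1, h2, hsQ_units_conj k hk, hsQ_units_conj k hk]

/-- Support control: `α(x) ≠ 0 → Q(x - 1) < r_out`. [folklore] -/
theorem hsQ_lt_of_archBump_ne_zero {x : GL (Fin n) (mixedSpace K)} (hx : archBump φ x ≠ 0) :
    hsQ ((x : Matrix (Fin n) (Fin n) (mixedSpace K)) - 1) < φ.rOut := by
  have h1 : φ (hsQ ((x : Matrix (Fin n) (Fin n) (mixedSpace K)) - 1)) ≠ 0 := left_ne_zero_of_mul hx
  have h2 := φ.support_eq ▸ Function.mem_support.2 h1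
  rw [Metric.mem_ball, Real.dist_eq, sub_zero] at h2
  exact lt_of_abs_lt h2

set_option backward.isDefEq.respectTransparency false in
/-- `α` is continuous on `GL_n(K ⊗ ℝ)`. [folklore] -/
theorem continuous_archBump : Continuous (archBump (n := n) (K := K) φ) := by
  unfold archBump
  refine ((φ.continuous.comp (continuous_hsQ.comp ?_)).mul
    (φ.continuous.comp (continuous_hsQ.comp ?_)))
  · exact Units.continuous_val.sub continuous_const
  · exact (Units.continuous_val.comp continuous_inv).sub continuous_const

set_option backward.isDefEq.respectTransparency false in
/-- **`α` is smooth along the exponential chart**: `X ↦ α(x₀ exp X)` is `C^∞` on `M_n(K ⊗ ℝ)`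
(`(x₀ exp X)⁻¹ = exp(-X) x₀⁻¹`). [folklore] -/
theorem contDiff_archBump_mul_expGL (x₀ : GL (Fin n) (mixedSpace K)) :
    ContDiff ℝ ∞ fun X : Matrix (Fin n) (Fin n) (mixedSpace K) ↦ archBump φ (x₀ * expGL X) := by
  have hexp := contDiff_exp_matrix_mixedSpace (n := n) (K := K)
  have hfun : (fun X : Matrix (Fin n) (Fin n) (mixedSpace K) ↦ archBump φ (x₀ * expGL X)) =
      fun X ↦ φ (hsQ ((x₀ : Matrix (Fin n) (Fin n) (mixedSpace K)) * NormedSpace.exp X - 1)) *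
        φ (hsQ (NormedSpace.exp (-X) *
          ((x₀⁻¹ : GL (Fin n) (mixedSpace K)) : Matrix (Fin n) (Fin n) (mixedSpace K)) - 1)) := by
    funext X
    unfold archBump
    rw [Units.val_mul, coe_expGL, mul_inv_rev, Units.val_mul, ← expGL_neg, coe_expGL]
  rw [hfun]
  refine ((φ.contDiff.comp contDiff_hsQ).comp ?_).mul ((φ.contDiff.comp contDiff_hsQ).comp ?_)
  · exact (contDiff_const.mul hexp).sub contDiff_const
  · exact ((hexp.comp contDiff_neg).mul contDiff_const).sub contDiff_const

end ArchBump

/-! ### 3. The bump on `GL_n(𝔸_K)` -/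

section Bump

variable (n : ℕ) (K : Type) [Field K] [NumberField K]
  (hcpt : isCompact_glFiniteIntegralLevel n K)

-- the scoped operator norm on `𝔤𝔩_n(K_∞)` and the transparency setting, as in `HSForm` above
set_option backward.isDefEq.respectTransparency false in
open scoped Matrix.Norms.Operator in
/-- **W1 holds: `Ad K_∞`-invariant symmetric test functions with small support exist**
(discharge of `AutomorphicRepsGL.exists_adInvariant_symmetric_testWeight hcpt` of
`AutomorphicRepsGLCuspidalL2Step1KFinite`). Given `V ∈ 𝓝 1`: choose an open `V₁ ∋ 1` with
`V₁ V₁ ⊆ V`, a principal congruence subgroup `K(𝔫) ⊆ V₁`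
(`exists_principalCongruenceLevel_subset`), `ε₀ > 0` with `{x | ‖x - 1‖ < ε₀} ⊆ {x | (x, 1) ∈ V₁}`
(units are open in `M_n(K ⊗ ℝ)`), `r > 0` with `Q(z) < r → ‖z‖ < ε₀/2` (coercivity of the
Hilbert–Schmidt form `Q`), and a bump `φ` on `ℝ` supported in `(-r, r)` with `φ = 1` near `0`; put
`η(g) = φ(Q(g_∞ - 1)) φ(Q(g_∞⁻¹ - 1)) · 1_{K_f(𝔫)}(g_f)`. Then `η` is a test function (smooth in
`g_∞` along `x₀ exp X`, locally constant in `g_f`, right `K(𝔫)`-invariant, supported in the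
compact `({‖x - 1‖ ≤ ε₀/2}, 1) · K(𝔫) ⊆ V₁ V₁ ⊆ V`), `η ≥ 0`, `η(1) = 1` (so `∫ η > 0`),
`η(g⁻¹) = η(g)`, `η(k g k⁻¹) = η(g)` for `k ∈ K_∞ = U(n, K ⊗ ℝ)` (`Q` is `Ad K_∞`-invariant),
and `η(u g) = η(g)` for `u ∈ K(𝔫)`. This is the construction of the tree's
`exists_isTestFunctionGL_support_subset` (`GLnCuspidalSpectrumSiegelProofs`) with the archimedean
bump replaced by a conjugation-invariant symmetric one; Bump (1997), proof of Lemma 2.3.2, PDF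
p. 163 (`φ₀(g) = φ₀(g⁻¹)`, `φ₀(κ g κ⁻¹) = φ₀(g)`).
[cite: Bump1997, proof of Lemma 2.3.2 (PDF p. 163)] -/
theorem AutomorphicRepsGL.exists_adInvariant_symmetric_testWeight_holds :
    AutomorphicRepsGL.exists_adInvariant_symmetric_testWeight hcpt := by
  intro V hV
  -- an open `V₁ ∋ 1` with `V₁ V₁ ⊆ V`, and a level `K(𝔫) ⊆ V₁`
  obtain ⟨V₁, hV₁o, h1V₁, hVV⟩ := exists_open_nhds_one_mul_subset hV
  obtain ⟨𝔫, h𝔫, hKV⟩ := exists_principalCongruenceLevel_subset n K (hV₁o.mem_nhds h1V₁)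
  -- the archimedean neighbourhood `W = {x | (x, 1) ∈ V₁}` as a neighbourhood of `1` in matrices
  have hVinf : (GLn.ofInfinite n K) ⁻¹' V₁ ∈ 𝓝 (1 : GL (Fin n) (mixedSpace K)) :=
    (GLn.continuous_ofInfinite n K).continuousAt.preimage_mem_nhds
      (by rw [map_one]; exact hV₁o.mem_nhds h1V₁)
  have hW : (Units.val '' ((GLn.ofInfinite n K) ⁻¹' V₁)) ∈
      𝓝 (1 : Matrix (Fin n) (Fin n) (mixedSpace K)) := by
    have h := (Units.isOpenEmbedding_val
      (R := Matrix (Fin n) (Fin n) (mixedSpace K))).image_mem_nhds.2 hVinf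
    rwa [Units.val_one] at h
  obtain ⟨ε₀, hε₀, hball⟩ := Metric.mem_nhds_iff.1 hW
  -- the radius of the bump, by coercivity of `Q`
  obtain ⟨r, hr, hrε⟩ := exists_hsQ_lt_imp_norm_lt (n := n) (K := K) (half_pos hε₀)
  let φ : ContDiffBump (0 : ℝ) := ⟨r / 2, r, half_pos hr, half_lt_self hr⟩
  have hφr : φ.rOut = r := rfl
  -- `α x ≠ 0 → ‖x - 1‖ < ε₀ / 2`
  have hαsupp : ∀ x : GL (Fin n) (mixedSpace K), archBump φ x ≠ 0 →
      ‖(x : Matrix (Fin n) (Fin n) (mixedSpace K)) - 1‖ < ε₀ / 2 := fun x hx ↦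
    hrε _ (hφr ▸ hsQ_lt_of_archBump_ne_zero φ hx)
  have hαV : ∀ x : GL (Fin n) (mixedSpace K), archBump φ x ≠ 0 → GLn.ofInfinite n K x ∈ V₁ := by
    intro x hx
    have hxb : (x : Matrix (Fin n) (Fin n) (mixedSpace K)) ∈ Metric.ball 1 ε₀ := by
      rw [Metric.mem_ball, dist_eq_norm]
      linarith [hαsupp x hx, hε₀]
    obtain ⟨u, hu, hueq⟩ := hball hxb
    have : u = x := Units.ext hueq
    rw [← this]
    exact hu
  -- the finite part: the clopen set `{g | g_f ∈ K_f(𝔫)}`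
  set S : Set (GL (Fin n) (AdeleRing (𝓞 K) K)) := (GLn.sndHom n K) ⁻¹'
    (finitePrincipalCongruenceLevel n K 𝔫 : Set (GL (Fin n) (FiniteAdeleRing (𝓞 K) K))) with hS
  have hSclopen : IsClopen S := isClopen_preimage_sndHom_finitePrincipalCongruenceLevel n K h𝔫
  have hS_iff : ∀ g : GL (Fin n) (AdeleRing (𝓞 K) K), g ∈ S ↔
      GLn.ofFinite n K (GLn.sndHom n K g) ∈ principalCongruenceLevel n K 𝔫 := fun g ↦ Iff.rfl
  have hS_mul : ∀ (g : GL (Fin n) (AdeleRing (𝓞 K) K)) (h : GL (Fin n) (mixedSpace K)),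
      g * GLn.ofInfinite n K h ∈ S ↔ g ∈ S := by
    intro g h
    rw [hS_iff, hS_iff, map_mul, GLn.sndHom_ofInfinite, mul_one]
  have hS_mul' : ∀ (g : GL (Fin n) (AdeleRing (𝓞 K) K)) (h : GL (Fin n) (mixedSpace K)),
      GLn.ofInfinite n K h * g ∈ S ↔ g ∈ S := by
    intro g h
    rw [hS_iff, hS_iff, map_mul, GLn.sndHom_ofInfinite, one_mul]
  have hS_inv : ∀ g : GL (Fin n) (AdeleRing (𝓞 K) K), g⁻¹ ∈ S ↔ g ∈ S := by
    intro g
    rw [hS_iff, hS_iff, map_inv, map_inv]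
    exact Subgroup.inv_mem_iff _
  -- the function
  set η : GL (Fin n) (AdeleRing (𝓞 K) K) → ℝ := fun g ↦
    archBump φ (GLn.toMixed n K g) * S.indicator (fun _ ↦ (1 : ℝ)) g with hη
  have hη_apply : ∀ g, η g = archBump φ (GLn.toMixed n K g) * S.indicator (fun _ ↦ (1 : ℝ)) g :=
    fun g ↦ rfl
  have hind0 : ∀ g, 0 ≤ S.indicator (fun _ ↦ (1 : ℝ)) g := fun g ↦
    Set.indicator_nonneg (fun _ _ ↦ zero_le_one) g
  have hη0 : ∀ g, 0 ≤ η g := fun g ↦ mul_nonneg (archBump_nonneg φ _) (hind0 g)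
  -- support control: `η g ≠ 0 → (g_∞, 1) ∈ V₁ ∧ (1, g_f) ∈ K(𝔫)`
  have hsupp : ∀ g, η g ≠ 0 →
      GLn.ofInfinite n K (GLn.toMixed n K g) ∈ V₁ ∧
        GLn.ofFinite n K (GLn.sndHom n K g) ∈ principalCongruenceLevel n K 𝔫 := by
    intro g hg
    rw [hη_apply] at hg
    have hSg : g ∈ S := by
      by_contra hgS
      rw [Set.indicator_of_notMem hgS, mul_zero] at hg
      exact hg rfl
    exact ⟨hαV _ (left_ne_zero_of_mul hg), (hS_iff g).1 hSg⟩
  have hcont : Continuous η :=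
    ((continuous_archBump φ).comp (GLn.continuous_toMixed n K)).mul
      (hSclopen.continuous_indicator continuous_const)
  -- compact support: `supp η ⊆ (C, 1) · K(𝔫)`, `C = {x | ‖x - 1‖ ≤ ε₀/2}` compact in `GL_n(K_∞)`
  have hcs : HasCompactSupport η := by
    haveI : ProperSpace (Matrix (Fin n) (Fin n) (mixedSpace K)) := FiniteDimensional.proper ℝ _
    set C : Set (GL (Fin n) (mixedSpace K)) :=
      Units.val ⁻¹' Metric.closedBall (1 : Matrix (Fin n) (Fin n) (mixedSpace K)) (ε₀ / 2) with hC
    have hCsub : Metric.closedBall (1 : Matrix (Fin n) (Fin n) (mixedSpace K)) (ε₀ / 2) ⊆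
        Set.range (Units.val :
          GL (Fin n) (mixedSpace K) → Matrix (Fin n) (Fin n) (mixedSpace K)) := by
      intro y hy
      have hyb : y ∈ Metric.ball (1 : Matrix (Fin n) (Fin n) (mixedSpace K)) ε₀ :=
        Metric.closedBall_subset_ball (half_lt_self hε₀) hy
      obtain ⟨u, -, rfl⟩ := hball hyb
      exact ⟨u, rfl⟩
    have hCc : IsCompact C :=
      (Units.isOpenEmbedding_val
        (R := Matrix (Fin n) (Fin n) (mixedSpace K))).isInducing.isCompact_preimage'
        (isCompact_closedBall _ _) hCsub
    refine HasCompactSupport.of_support_subset_isCompact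
      ((hCc.image (GLn.continuous_ofInfinite n K)).mul (isCompact_principalCongruenceLevel n K h𝔫))
      fun g hg ↦ ?_
    obtain ⟨-, h2⟩ := hsupp g hg
    have hαg : archBump φ (GLn.toMixed n K g) ≠ 0 := by
      rw [Function.mem_support, hη_apply] at hg
      exact left_ne_zero_of_mul hg
    have h1 : GLn.toMixed n K g ∈ C := by
      rw [hC, Set.mem_preimage, Metric.mem_closedBall, dist_eq_norm]
      exact (hαsupp _ hαg).le
    rw [← GLn.ofInfinite_toMixed_mul_ofFinite_sndHom g]
    exact Set.mul_mem_mul (Set.mem_image_of_mem _ h1) h2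
  refine ⟨principalCongruenceLevel n K 𝔫, principalCongruenceLevel_mem_finiteLevelsGL_holds n K h𝔫,
    η, ⟨hcont, hcs, ?_, ?_⟩, hη0, ?_, ?_, ?_, ?_, ?_⟩
  · -- archimedean smoothness
    intro (g : GL (Fin n) (AdeleRing (𝓞 K) K))
    show ContDiff ℝ ∞ fun X : (archGroupGL n K).lie.toSubmodule ↦
      ((η (g * GLn.ofInfinite n K (expGL (X : Matrix (Fin n) (Fin n) (mixedSpace K)))) : ℝ) : ℂ)
    have hconst : (fun X : (archGroupGL n K).lie.toSubmodule ↦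
        ((η (g * GLn.ofInfinite n K (expGL (X : Matrix (Fin n) (Fin n) (mixedSpace K)))) : ℝ) :
          ℂ)) =
        fun X : (archGroupGL n K).lie.toSubmodule ↦
          ((archBump φ (GLn.toMixed n K g * expGL (X : Matrix (Fin n) (Fin n) (mixedSpace K))) *
            S.indicator (fun _ ↦ (1 : ℝ)) g : ℝ) : ℂ) := by
      funext X
      rw [hη_apply, map_mul, GLn.toMixed_ofInfinite]
      congr 2
      rw [Set.indicator_apply, Set.indicator_apply]
      simp only [hS_mul]
    rw [hconst]
    have hval : ContDiff ℝ ∞ fun X : (archGroupGL n K).lie.toSubmodule ↦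
        (X : Matrix (Fin n) (Fin n) (mixedSpace K)) :=
      (archGroupGL n K).lie.toSubmodule.subtypeL.contDiff
    exact Complex.ofRealCLM.contDiff.comp
      (((contDiff_archBump_mul_expGL φ (GLn.toMixed n K g)).comp hval).mul contDiff_const)
  · -- right invariance under `K(𝔫)`
    refine ⟨principalCongruenceLevel n K 𝔫,
      principalCongruenceLevel_mem_finiteLevelsGL_holds n K h𝔫, fun u hu g ↦ ?_⟩
    have hu' : GLn.ofFinite n K (GLn.sndHom n K u) = u :=
      GLn.ofFinite_sndHom_of_mem (principalCongruenceLevel_le n K 𝔫 hu)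
    have htm : GLn.toMixed n K u = 1 := by rw [← hu', GLn.toMixed_ofFinite]
    have hSu : g * u ∈ S ↔ g ∈ S := by
      rw [hS_iff, hS_iff, map_mul, map_mul, hu']
      exact Subgroup.mul_mem_cancel_right _ hu
    rw [hη_apply, hη_apply, map_mul, htm, mul_one]
    congr 1
    rw [Set.indicator_apply, Set.indicator_apply]
    simp only [hSu]
  · -- symmetry under `g ↦ g⁻¹`
    intro (g : GL (Fin n) (AdeleRing (𝓞 K) K))
    change η g⁻¹ = η g
    rw [hη_apply, hη_apply, map_inv, archBump_inv]
    congr 1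
    rw [Set.indicator_apply, Set.indicator_apply]
    simp only [hS_inv]
  · -- `Ad K_∞`-invariance
    intro k (g : GL (Fin n) (AdeleRing (𝓞 K) K))
    change η (GLn.ofInfinite n K (k : GL (Fin n) (mixedSpace K)) * g *
      (GLn.ofInfinite n K (k : GL (Fin n) (mixedSpace K)))⁻¹) = η g
    have hk : star ((k : GL (Fin n) (mixedSpace K)) : Matrix (Fin n) (Fin n) (mixedSpace K)) *
        ((k : GL (Fin n) (mixedSpace K)) : Matrix (Fin n) (Fin n) (mixedSpace K)) = 1 :=
      (mem_unitarySubgroupGL_iff _).1 (Subgroup.mem_inf.1 k.2).2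
    have hSk : GLn.ofInfinite n K (k : GL (Fin n) (mixedSpace K)) * g *
        (GLn.ofInfinite n K (k : GL (Fin n) (mixedSpace K)))⁻¹ ∈ S ↔ g ∈ S := by
      rw [← map_inv, hS_mul, hS_mul']
    rw [hη_apply, hη_apply, map_mul, map_mul, map_inv, GLn.toMixed_ofInfinite, archBump_conj φ hk]
    congr 1
    rw [Set.indicator_apply, Set.indicator_apply]
    simp only [hSk]
  · -- left invariance under `K(𝔫)`
    intro (u : GL (Fin n) (AdeleRing (𝓞 K) K)) hu (g : GL (Fin n) (AdeleRing (𝓞 K) K))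
    change η (u * g) = η g
    have hu' : GLn.ofFinite n K (GLn.sndHom n K u) = u :=
      GLn.ofFinite_sndHom_of_mem (principalCongruenceLevel_le n K 𝔫 hu)
    have htm : GLn.toMixed n K u = 1 := by rw [← hu', GLn.toMixed_ofFinite]
    have hSu : u * g ∈ S ↔ g ∈ S := by
      rw [hS_iff, hS_iff, map_mul, map_mul, hu']
      exact Subgroup.mul_mem_cancel_left _ hu
    rw [hη_apply, hη_apply, map_mul, htm, one_mul]
    congr 1
    rw [Set.indicator_apply, Set.indicator_apply]
    simp only [hSu]
  · -- positivity of the integral: `η ≥ 0` continuous of compact support with `η 1 = 1`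
    have h1S : (1 : GL (Fin n) (AdeleRing (𝓞 K) K)) ∈ S := by
      rw [hS_iff, map_one, map_one]
      exact one_mem _
    have hη1 : η 1 = 1 := by
      rw [hη_apply, map_one, archBump_one, Set.indicator_of_mem h1S, mul_one]
    -- (typed through the adelic group datum, where the Borel structure and `adelicHaar` live)
    have hcont' : @Continuous (AdelicGroupData.gl n K).Adelic ℝ _ _ η := hcont
    have hcs' : @HasCompactSupport (AdelicGroupData.gl n K).Adelic ℝ _ _ η := hcs
    exact hcont'.integral_pos_of_hasCompactSupport_nonneg_nonzero hcs' hη0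
      (by rw [hη1]; exact one_ne_zero)
  · -- support
    intro (g : GL (Fin n) (AdeleRing (𝓞 K) K)) hg
    obtain ⟨h1, h2⟩ := hsupp g hg
    change g ∈ V
    rw [← GLn.ofInfinite_toMixed_mul_ofFinite_sndHom g]
    exact hVV (Set.mul_mem_mul h1 (hKV h2))

/-- **F1a from the Siegel estimate, reduction theory and unimodularity** (the bumps W1 being
proved): `AutomorphicRepsGL.exists_kFinite_garding_fixed_of` of
`AutomorphicRepsGLCuspidalL2Step1KFinite` with its last hypothesis discharged by
`AutomorphicRepsGL.exists_adInvariant_symmetric_testWeight_holds`. Bump (1997), proof of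
Thm. 3.2.3 (PDF p. 281). [cite: Bump1997, proof of Thm. 3.2.3 (PDF p. 281)] -/
theorem AutomorphicRepsGL.exists_kFinite_garding_fixed_of' {hcpt}
    {μ : Measure (AdelicGroupData.gl n K).automorphicQuotient}
    [(AdelicGroupData.gl n K).IsAutomorphicMeasure μ]
    (hBE : GLnCuspidalSpectrum.norm_smoothedForm_le_of_isSiegelSetGL n K μ)
    (hRT : reductionTheory_gl n K) (hU1 : GLn.isMulRightInvariant_of_isHaarMeasure_adelic n K) :
    AutomorphicRepsGL.exists_kFinite_garding_fixed hcpt μ :=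
  AutomorphicRepsGL.exists_kFinite_garding_fixed_of hBE hRT hU1
    (AutomorphicRepsGL.exists_adInvariant_symmetric_testWeight_holds n K hcpt)

end Bump

end Literature.NumberTheory.Automorphic
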